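import Summits.CriticalPhenomena.Ising3DConformalLimit.Theorems.FKParityRobustnessParityBoundCurrents
import Literature.Probability.LatticeModels.CurrentSwitching
import Literature.Probability.LatticeModels.LoopO1
import HarnessLib

/-!
# Two-current trace dictionary, current side (helper for `twoCurrentTraceDictionary`,
# line `odd-cluster-cut-exact-helper` of item stmt-CriticalPhenomena-14626, route `FKParityRobustness`)

For a finite graph `G`, a second graph `G₁` (`E₁ = E(G) ∩ E(G₁)`), `β ≥ 0`, currents `n₁ ⊆ E(G₁)` with
`∂n₁ = A` and `n₂` on `G` with `∂n₂ = B`, we expand the double current sum of `g(E₁ ∩ trace(n₁+n₂))`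
along the odd parts `F = odd(n₁)`, `F′ = odd(n₂)` and the trace `T`: per edge the multiplicity series
are `∑_{odd} βᵏ/k! = sinh β`, `∑_{even} = cosh β`, `∑_{even ≥ 2} ⊗ ∑_{even} − 1 = cosh² β − 1 = sinh² β`
(`dict_edge_tsum`), giving `twoCurrentTraceExpansion`: the sum equals
`∑_{F,F′,T} 1[∂F = A] 1[∂F′ = B] g(T) ∏_e r_e(F,F′,T)` with an explicit edge factor `r_e` in
`t = tanh β`.  Theorem-only file (Aizenman 1982 §3; Duminil-Copin 2016, Remark 3.4;
Hansen–Jiang–Klausen 2025 §2: the trace of a sourced current is `ℓ^A_t ∪ Bernoulli`).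
-/

noncomputable section

open Finset SimpleGraph
open scoped ENNReal symmDiff
open Literature.Probability.LatticeModels

namespace Summit.CriticalPhenomena.Ising3DConformalLimit.Theorems.StrandShadowOddCut

open scoped Classical

/-- `cosh β · tanh β = sinh β`. [folklore] -/
theorem dict_cosh_mul_tanh (β : ℝ) : Real.cosh β * Real.tanh β = Real.sinh β := by
  rw [Real.tanh_eq_sinh_div_cosh, mul_div_cancel₀ _ (Real.cosh_pos β).ne']

/-- `cosh² β · (1 - tanh² β) = 1`. [folklore] -/
theorem dict_cosh_sq_mul_one_sub_tanh_sq (β : ℝ) :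
    Real.cosh β ^ 2 * (1 - Real.tanh β ^ 2) = 1 := by
  have h := Real.cosh_sq_sub_sinh_sq β
  rw [← dict_cosh_mul_tanh] at h
  linear_combination h

/-- `1 - tanh² β ≥ 0`. [folklore] -/
theorem dict_one_sub_tanh_sq_nonneg (β : ℝ) : 0 ≤ 1 - Real.tanh β ^ 2 :=
  sub_nonneg.2 (Real.tanh_sq_lt_one β).le

/-- The one-edge series `∑_{k : Odd k ↔ p} βᵏ/k! = cosh β · (tanh β if p, else 1)`, i.e. `sinh β` or
`cosh β`. [folklore] -/
theorem dict_tsum_ind_odd_iff {β : ℝ} (hβ : 0 ≤ β) (p : Prop) [Decidable p] :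
    ∑' k, ind (Odd k ↔ p) * edgeWeight β k =
      ENNReal.ofReal (Real.cosh β * if p then Real.tanh β else 1) := by
  have ht : 0 ≤ Real.tanh β := by
    rw [Real.tanh_eq_sinh_div_cosh]; exact div_nonneg (Real.sinh_nonneg_iff.2 hβ) (Real.cosh_pos β).le
  by_cases hp : p
  · rw [if_pos hp, mul_comm (Real.cosh β), ENNReal.ofReal_mul ht, ← tsum_edgeWeight_odd_eq hβ]
    refine tsum_congr fun k => ?_
    rw [mul_comm, ind_congr (iff_true_right hp)]
  · rw [if_neg hp, mul_one, ← tsum_edgeWeight_even_eq_ofReal hβ]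
    refine tsum_congr fun k => ?_
    rw [mul_comm, ind_congr ((iff_false_right hp).trans Nat.not_odd_iff_even)]

/-- **Per-edge double series** of the two-current trace dictionary.  For one edge with data
`a = (e ∈ F)`, `b = (e ∈ F′)`, `m = (e ∈ E(G₁))`, `c = (e ∈ T)`:
`∑_{j,k} 1[Odd j ↔ a] 1[¬m → j = 0] 1[Odd k ↔ b] 1[m → (c ↔ j + k > 0)] βʲ/j! βᵏ/k!` in closed form
(`∑_{odd} = sinh`, `∑_{even} = cosh`, `∑_{even ≥ 2} ⊗ … = cosh² − 1 = sinh²`). [folklore] -/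
theorem dict_edge_tsum {β : ℝ} (hβ : 0 ≤ β) (a b m m₀ c : Prop) [Decidable a] [Decidable b]
    [Decidable m] [Decidable c] (hm₀ : m₀) :
    ∑' j : ℕ, ∑' k : ℕ, ind ((Odd j ↔ a) ∧ (¬ m → j = 0)) * edgeWeight β j *
        (ind ((Odd k ↔ b) ∧ (¬ m₀ → k = 0)) * edgeWeight β k) * ind (m → (c ↔ 0 < j + k)) =
      ENNReal.ofReal ((if b then Real.tanh β else 1) *
        (if m then Real.cosh β ^ 2 * (if a then Real.tanh β else 1) *
          (if a ∨ b then (if c then 1 else 0) else (if c then Real.tanh β ^ 2 else 1 - Real.tanh β ^ 2))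
        else (if a then 0 else 1) * Real.cosh β)) := by
  have ht : 0 ≤ Real.tanh β := by
    rw [Real.tanh_eq_sinh_div_cosh]; exact div_nonneg (Real.sinh_nonneg_iff.2 hβ) (Real.cosh_pos β).le
  have hc0 : 0 < Real.cosh β := Real.cosh_pos β
  have h0a : (Odd 0 ↔ a) ↔ ¬ a := iff_false_left Nat.not_odd_zero
  have h0b : (Odd 0 ↔ b) ↔ ¬ b := iff_false_left Nat.not_odd_zero
  have hk : ∀ k, ind ((Odd k ↔ b) ∧ (¬ m₀ → k = 0)) = ind (Odd k ↔ b) := fun k =>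
    ind_congr ⟨fun h => h.1, fun h => ⟨h, fun h' => absurd hm₀ h'⟩⟩
  simp_rw [hk]
  by_cases hm : m
  · have hj : ∀ j, ind ((Odd j ↔ a) ∧ (¬ m → j = 0)) = ind (Odd j ↔ a) := fun j =>
      ind_congr ⟨fun h => h.1, fun h => ⟨h, fun h' => absurd hm h'⟩⟩
    have hi : ∀ j k : ℕ, ind (m → (c ↔ 0 < j + k)) = ind (c ↔ 0 < j + k) := fun j k =>
      ind_congr ⟨fun h => h hm, fun h _ => h⟩
    simp_rw [hj, hi, if_pos hm]
    by_cases hc : c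
    · by_cases hab : a ∨ b
      · -- the positivity indicator is automatic
        have h1 : ∀ j k : ℕ, ind (Odd j ↔ a) * edgeWeight β j * (ind (Odd k ↔ b) * edgeWeight β k) *
            ind (c ↔ 0 < j + k) =
            ind (Odd j ↔ a) * edgeWeight β j * (ind (Odd k ↔ b) * edgeWeight β k) := by
          intro j k
          by_cases hja : (Odd j ↔ a)
          · by_cases hkb : (Odd k ↔ b)
            · rw [ind_of_true (show c ↔ 0 < j + k from iff_of_true hc ?_), mul_one]
              rcases hab with h | h
              · exact Nat.add_pos_left (hja.2 h).pos k
              · exact Nat.add_pos_right j (hkb.2 h).pos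
            · rw [ind_of_false hkb, zero_mul, mul_zero, zero_mul]
          · rw [ind_of_false hja, zero_mul, zero_mul, zero_mul]
        simp_rw [h1, ENNReal.tsum_mul_left, dict_tsum_ind_odd_iff hβ, ENNReal.tsum_mul_right,
          dict_tsum_ind_odd_iff hβ]
        rw [if_pos hab, if_pos hc, ← ENNReal.ofReal_mul (by positivity)]
        congr 1
        ring
      · have ha : ¬ a := fun h => hab (Or.inl h)
        have hb : ¬ b := fun h => hab (Or.inr h)
        rw [if_neg hab, if_pos hc, if_neg ha, if_neg hb]
        -- `X + 1 = cosh²`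
        have hsplit : (∑' j : ℕ, ∑' k : ℕ, ind (Odd j ↔ a) * edgeWeight β j *
            (ind (Odd k ↔ b) * edgeWeight β k) * ind (c ↔ 0 < j + k)) + 1 =
            (∑' j : ℕ, ind (Odd j ↔ a) * edgeWeight β j) * ∑' k : ℕ, ind (Odd k ↔ b) * edgeWeight β k := by
          have hone : (1 : ℝ≥0∞) = ∑' j : ℕ, ∑' k : ℕ, ind (Odd j ↔ a) * edgeWeight β j *
              (ind (Odd k ↔ b) * edgeWeight β k) * ind (¬ (0 < j + k)) := by
            rw [tsum_eq_single 0 fun j hj => ENNReal.tsum_eq_zero.2 fun k => by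
              rw [ind_of_false (fun h : ¬ (0 < j + k) => h (by omega)), mul_zero],
              tsum_eq_single 0 fun k hk => by
                rw [ind_of_false (fun h : ¬ (0 < 0 + k) => h (by omega)), mul_zero]]
            rw [ind_of_true (h0a.2 ha), ind_of_true (h0b.2 hb), ind_of_true (lt_irrefl 0),
              edgeWeight_zero]
            simp
          rw [hone, ← ENNReal.tsum_add, ← ENNReal.tsum_mul_right]
          refine tsum_congr fun j => ?_
          rw [← ENNReal.tsum_add, ← ENNReal.tsum_mul_left]
          refine tsum_congr fun k => ?_
          rw [← mul_add, ind_congr (iff_true_left hc)]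
          by_cases hjk : 0 < j + k
          · rw [ind_of_true hjk, ind_of_false (not_not.2 hjk), add_zero, mul_one]
          · rw [ind_of_false hjk, ind_of_true hjk, zero_add, mul_one]
        rw [dict_tsum_ind_odd_iff hβ, dict_tsum_ind_odd_iff hβ, if_neg ha, if_neg hb, mul_one,
          ← ENNReal.ofReal_mul hc0.le, ← pow_two, Real.cosh_sq, ENNReal.ofReal_add (sq_nonneg _)
          zero_le_one, ENNReal.ofReal_one, ENNReal.add_left_inj ENNReal.one_ne_top] at hsplit
        rw [hsplit]
        congr 1
        rw [← dict_cosh_mul_tanh]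
        ring
    · -- `¬ c`: only the zero pair contributes
      rw [tsum_eq_single 0 fun j hj => ENNReal.tsum_eq_zero.2 fun k => by
          rw [ind_of_false (fun h : (c ↔ 0 < j + k) => hc (h.2 (by omega))), mul_zero],
        tsum_eq_single 0 fun k hk => by
          rw [ind_of_false (fun h : (c ↔ 0 < 0 + k) => hc (h.2 (by omega))), mul_zero]]
      rw [ind_congr h0a, ind_congr h0b, ind_of_true (iff_of_false hc (lt_irrefl 0)), edgeWeight_zero,
        mul_one, mul_one, mul_one, if_neg hc, if_neg hc]
      by_cases ha : a
      · rw [ind_of_false (not_not.2 ha), zero_mul, if_pos (Or.inl ha)]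
        simp
      · by_cases hb : b
        · rw [ind_of_false (not_not.2 hb), mul_zero, if_pos (Or.inr hb)]
          simp
        · rw [ind_of_true ha, ind_of_true hb, mul_one, if_neg (not_or.2 ⟨ha, hb⟩), if_neg ha,
            if_neg hb, one_mul, mul_one, dict_cosh_sq_mul_one_sub_tanh_sq, ENNReal.ofReal_one]
  · -- `¬ m`: the first multiplicity vanishes
    have hj : ∀ j, ind ((Odd j ↔ a) ∧ (¬ m → j = 0)) = ind ((Odd j ↔ a) ∧ j = 0) := fun j =>
      ind_congr ⟨fun h => ⟨h.1, h.2 hm⟩, fun h => ⟨h.1, fun _ => h.2⟩⟩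
    have hi : ∀ j k : ℕ, ind (m → (c ↔ 0 < j + k)) = 1 := fun j k =>
      ind_of_true fun h => absurd h hm
    simp_rw [hj, hi, mul_one, if_neg hm, ENNReal.tsum_mul_left, dict_tsum_ind_odd_iff hβ,
      ENNReal.tsum_mul_right]
    rw [tsum_eq_single 0 fun j hj => by rw [ind_of_false (fun h => hj h.2), zero_mul],
      edgeWeight_zero, mul_one]
    by_cases ha : a
    · rw [ind_of_false (fun h => Nat.not_odd_zero (h.1.2 ha)), zero_mul, if_pos ha]
      simp
    · rw [ind_of_true ⟨h0a.2 ha, rfl⟩, one_mul, if_neg ha]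
      congr 1
      ring

/-- Product formula for a pair of multiplicity functions on a finite index type:
`∑_{n₁} ∑_{n₂} ∏_i f_i(n₁ i, n₂ i) = ∏_i ∑_j ∑_k f_i(j, k)` in `ℝ≥0∞`. [folklore] -/
theorem dict_tsum_tsum_prod {ι : Type*} [Fintype ι] (f : ι → ℕ → ℕ → ℝ≥0∞) :
    ∑' n₁ : ι → ℕ, ∑' n₂ : ι → ℕ, ∏ i, f i (n₁ i) (n₂ i) = ∏ i, ∑' j, ∑' k, f i j k := by
  have h : ∀ n₁ : ι → ℕ, ∑' n₂ : ι → ℕ, ∏ i, f i (n₁ i) (n₂ i) = ∏ i, ∑' k, f i (n₁ i) k :=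
    fun n₁ => tsum_pi_nat_prod (fun i k => f i (n₁ i) k)
  simp_rw [h]
  exact tsum_pi_nat_prod (fun i j => ∑' k, f i j k)


section Decomposition

variable {V : Type*} [Fintype V] [DecidableEq V] {G : SimpleGraph V} [DecidableRel G.Adj]

/-- Decomposition of the sourced, supported current weight according to the odd part `F`:
`1[n ⊆ E(G₁), ∂n = A] w(n) = ∑_{F ⊆ E} 1[∂F = A] · 1[odd(n) = F, n ⊆ E(G₁)] w(n)`. [folklore] -/
theorem dict_ite_isSupp_sources (β : ℝ) (G₁ : SimpleGraph V) [DecidableRel G₁.Adj] (A : Finset V)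
    (n : Current G) :
    (if Current.IsSupp G₁ n ∧ n.sources = A then n.eweight (fun _ => β) else 0) =
      ∑ F ∈ G.edgeFinset.powerset, ind (∀ v, Odd #(F.filter (v ∈ ·)) ↔ v ∈ A) *
        (ind (∀ e : G.edgeFinset, (Odd (n e) ↔ (e : Sym2 V) ∈ F) ∧
            ((e : Sym2 V) ∉ G₁.edgeSet → n e = 0)) * n.eweight (fun _ => β)) := by
  have hsupp : (∀ e : G.edgeFinset, (Odd (n e) ↔ (e : Sym2 V) ∈
      (univ.filter fun e : G.edgeFinset => Odd (n e)).map (Function.Embedding.subtype _)) ∧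
        ((e : Sym2 V) ∉ G₁.edgeSet → n e = 0)) ↔ Current.IsSupp G₁ n := by
    constructor
    · intro h e he
      exact (h e).2 fun h' => he (mem_edgeFinset.2 h')
    · intro h e
      exact ⟨(mem_oddPart_iff n e).symm, fun he => h e fun h' => he (mem_edgeFinset.1 h')⟩
  rw [Finset.sum_eq_single ((univ.filter fun e : G.edgeFinset => Odd (n e)).map
    (Function.Embedding.subtype _))]
  · by_cases h : Current.IsSupp G₁ n ∧ n.sources = A
    · rw [if_pos h, ind_of_true ((sources_eq_iff_oddPart n A).1 h.2), ind_of_true (hsupp.2 h.1),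
        one_mul, one_mul]
    · rw [if_neg h]
      by_cases hs : Current.IsSupp G₁ n
      · rw [ind_of_false (fun h' => h ⟨hs, (sources_eq_iff_oddPart n A).2 h'⟩), zero_mul]
      · rw [ind_of_false (fun h' => hs (hsupp.1 h')), zero_mul, mul_zero]
  · intro F hF hne
    rw [ind_of_false (P := ∀ e : G.edgeFinset, _ ∧ _) (fun h' => hne
      ((forall_odd_iff_mem_iff n (mem_powerset.1 hF)).1 fun e => (h' e).1)), zero_mul, mul_zero]
  · intro h
    exact absurd (mem_powerset.2 (oddPart_subset n)) h

/-- The same decomposition without support condition (`G₁ = G`). [folklore] -/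
theorem dict_ite_sources (β : ℝ) (B : Finset V) (n : Current G) :
    (if n.sources = B then n.eweight (fun _ => β) else 0) =
      ∑ F ∈ G.edgeFinset.powerset, ind (∀ v, Odd #(F.filter (v ∈ ·)) ↔ v ∈ B) *
        (ind (∀ e : G.edgeFinset, (Odd (n e) ↔ (e : Sym2 V) ∈ F) ∧
            ((e : Sym2 V) ∉ G.edgeSet → n e = 0)) * n.eweight (fun _ => β)) := by
  rw [← dict_ite_isSupp_sources β G B n]
  exact if_congr ⟨fun h => ⟨Current.isSupp_self n, h⟩, fun h => h.2⟩ rfl rfl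

omit [DecidableEq V] in
/-- Decomposition of a function of the trace read on `E₁ = E(G) ∩ E(G₁)` according to its value
`T ⊆ E₁`. [folklore] -/
theorem dict_apply_filter_traced (G₁ : SimpleGraph V) [DecidableRel G₁.Adj]
    (g : Finset (Sym2 V) → ℝ≥0∞) (n₁ n₂ : Current G) :
    g ((G.edgeFinset.filter fun e => e ∈ G₁.edgeSet).filter fun e => e ∈ (n₁ + n₂).traced) =
      ∑ T ∈ (G.edgeFinset.filter fun e => e ∈ G₁.edgeSet).powerset,
        ind (∀ e : G.edgeFinset, (e : Sym2 V) ∈ G₁.edgeSet → (((e : Sym2 V) ∈ T) ↔ 0 < n₁ e + n₂ e)) *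
          g T := by
  set E₁ := G.edgeFinset.filter fun e => e ∈ G₁.edgeSet with hE₁
  set T₀ := E₁.filter fun e => e ∈ (n₁ + n₂).traced with hT₀
  have hT₀m : T₀ ∈ E₁.powerset := mem_powerset.2 (filter_subset _ _)
  have hiff : ∀ T ∈ E₁.powerset, (∀ e : G.edgeFinset, (e : Sym2 V) ∈ G₁.edgeSet →
      (((e : Sym2 V) ∈ T) ↔ 0 < n₁ e + n₂ e)) ↔ T = T₀ := by
    intro T hT
    rw [mem_powerset] at hT
    constructor
    · intro h
      ext x
      constructor
      · intro hx
        have hx₁ := mem_filter.1 (hT hx)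
        refine mem_filter.2 ⟨hT hx, (Current.mem_traced_iff _ ⟨x, hx₁.1⟩).2 ?_⟩
        exact (h ⟨x, hx₁.1⟩ hx₁.2).1 hx
      · intro hx
        obtain ⟨hx₁, hx₂⟩ := mem_filter.1 hx
        have hx₃ := mem_filter.1 hx₁
        exact (h ⟨x, hx₃.1⟩ hx₃.2).2 ((Current.mem_traced_iff _ ⟨x, hx₃.1⟩).1 hx₂)
    · rintro rfl e he
      rw [hT₀, mem_filter, hE₁, mem_filter, Current.mem_traced_iff]
      exact ⟨fun h => h.2, fun h => ⟨⟨e.2, he⟩, h⟩⟩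
  rw [sum_congr rfl fun T hT => by rw [ind_congr (hiff T hT)], sum_eq_single T₀
    (fun T _ hne => by rw [ind_of_false hne, zero_mul]) (fun h => absurd hT₀m h), ind_of_true rfl,
    one_mul]

/-- Edgewise factorisation of the pair summand with prescribed odd parts, support and trace:
the product over the edges of the per-edge factors is the product of the three indicators and the
two weights. [folklore] -/
theorem dict_prod_edge {β : ℝ} (hβ : 0 ≤ β) (G₁ : SimpleGraph V) [DecidableRel G₁.Adj]
    (F F' T : Finset (Sym2 V)) (n₁ n₂ : Current G) :
    ∏ e : G.edgeFinset, (ind ((Odd (n₁ e) ↔ (e : Sym2 V) ∈ F) ∧ ((e : Sym2 V) ∉ G₁.edgeSet → n₁ e = 0)) *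
        edgeWeight β (n₁ e) *
        (ind ((Odd (n₂ e) ↔ (e : Sym2 V) ∈ F') ∧ ((e : Sym2 V) ∉ G.edgeSet → n₂ e = 0)) *
          edgeWeight β (n₂ e)) *
        ind ((e : Sym2 V) ∈ G₁.edgeSet → (((e : Sym2 V) ∈ T) ↔ 0 < n₁ e + n₂ e))) =
      ind (∀ e : G.edgeFinset, (Odd (n₁ e) ↔ (e : Sym2 V) ∈ F) ∧ ((e : Sym2 V) ∉ G₁.edgeSet → n₁ e = 0)) *
          n₁.eweight (fun _ => β) *
        (ind (∀ e : G.edgeFinset, (Odd (n₂ e) ↔ (e : Sym2 V) ∈ F') ∧ ((e : Sym2 V) ∉ G.edgeSet → n₂ e = 0)) *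
          n₂.eweight (fun _ => β)) *
        ind (∀ e : G.edgeFinset, (e : Sym2 V) ∈ G₁.edgeSet → (((e : Sym2 V) ∈ T) ↔ 0 < n₁ e + n₂ e)) := by
  rw [prod_mul_distrib, prod_mul_distrib, prod_mul_distrib, prod_mul_distrib, prod_ind, prod_ind,
    prod_ind, eweight_const_eq_prod hβ, eweight_const_eq_prod hβ]
  simp only [mem_univ, forall_const]

/-- **Parity/trace decomposition of the two-current summand**: the weight of the pair `(n₁, n₂)`
times `g` of the trace on `E₁` is the sum over `(F, F′, T)` (odd parts and trace) of
`1[∂F = A] 1[∂F′ = B] g(T)` times an edgewise product. [folklore] -/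
theorem dict_summand_eq {β : ℝ} (hβ : 0 ≤ β) (G₁ : SimpleGraph V) [DecidableRel G₁.Adj]
    (A B : Finset V) (g : Finset (Sym2 V) → ℝ≥0∞)
    (φ : Finset (Sym2 V) → Finset (Sym2 V) → Finset (Sym2 V) → G.edgeFinset → ℕ → ℕ → ℝ≥0∞)
    (hφ : ∀ F F' T e j k, φ F F' T e j k =
      ind ((Odd j ↔ (e : Sym2 V) ∈ F) ∧ ((e : Sym2 V) ∉ G₁.edgeSet → j = 0)) * edgeWeight β j *
        (ind ((Odd k ↔ (e : Sym2 V) ∈ F') ∧ ((e : Sym2 V) ∉ G.edgeSet → k = 0)) * edgeWeight β k) *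
        ind ((e : Sym2 V) ∈ G₁.edgeSet → (((e : Sym2 V) ∈ T) ↔ 0 < j + k)))
    (n₁ n₂ : Current G) :
    (if Current.IsSupp G₁ n₁ ∧ n₁.sources = A then n₁.eweight (fun _ => β) else 0) *
        (if n₂.sources = B then n₂.eweight (fun _ => β) else 0) *
        g ((G.edgeFinset.filter fun e => e ∈ G₁.edgeSet).filter fun e => e ∈ (n₁ + n₂).traced) =
      ∑ F ∈ G.edgeFinset.powerset, ∑ F' ∈ G.edgeFinset.powerset,
        ∑ T ∈ (G.edgeFinset.filter fun e => e ∈ G₁.edgeSet).powerset,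
          ind (∀ v, Odd #(F.filter (v ∈ ·)) ↔ v ∈ A) * ind (∀ v, Odd #(F'.filter (v ∈ ·)) ↔ v ∈ B) *
            g T * ∏ e : G.edgeFinset, φ F F' T e (n₁ e) (n₂ e) := by
  have hprod : ∀ F F' T, ∏ e : G.edgeFinset, φ F F' T e (n₁ e) (n₂ e) =
      ind (∀ e : G.edgeFinset, (Odd (n₁ e) ↔ (e : Sym2 V) ∈ F) ∧ ((e : Sym2 V) ∉ G₁.edgeSet → n₁ e = 0)) *
          n₁.eweight (fun _ => β) *
        (ind (∀ e : G.edgeFinset, (Odd (n₂ e) ↔ (e : Sym2 V) ∈ F') ∧ ((e : Sym2 V) ∉ G.edgeSet → n₂ e = 0)) *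
          n₂.eweight (fun _ => β)) *
        ind (∀ e : G.edgeFinset, (e : Sym2 V) ∈ G₁.edgeSet → (((e : Sym2 V) ∈ T) ↔ 0 < n₁ e + n₂ e)) := by
    intro F F' T
    simp_rw [hφ]
    exact dict_prod_edge hβ G₁ F F' T n₁ n₂
  simp_rw [hprod]
  rw [dict_ite_isSupp_sources β G₁ A n₁, dict_ite_sources β B n₂, dict_apply_filter_traced G₁ g n₁ n₂,
    sum_mul_sum, sum_mul_sum]
  refine sum_congr rfl fun F _ => ?_
  simp_rw [sum_mul]
  rw [sum_comm]
  refine sum_congr rfl fun F' _ => sum_congr rfl fun T _ => ?_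
  ring

/-- Swapping a `tsum` with a triple finite sum (`ℝ≥0∞`). [folklore] -/
theorem dict_tsum_sum3 {α ι κ τ : Type*} (s₁ : Finset ι) (s₂ : Finset κ) (s₃ : Finset τ)
    (f : α → ι → κ → τ → ℝ≥0∞) :
    ∑' a, ∑ i ∈ s₁, ∑ j ∈ s₂, ∑ k ∈ s₃, f a i j k = ∑ i ∈ s₁, ∑ j ∈ s₂, ∑ k ∈ s₃, ∑' a, f a i j k := by
  rw [Summable.tsum_finsetSum (fun _ _ => ENNReal.summable)]
  refine sum_congr rfl fun i _ => ?_
  rw [Summable.tsum_finsetSum (fun _ _ => ENNReal.summable)]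
  refine sum_congr rfl fun j _ => ?_
  exact Summable.tsum_finsetSum (fun _ _ => ENNReal.summable)

end Decomposition


section Chains

variable {V : Type*} [Fintype V] [DecidableEq V] {G : SimpleGraph V} [DecidableRel G.Adj]

omit [Fintype V] [DecidableRel G.Adj] in
/-- The per-edge factors `r` are nonnegative. [folklore] -/
theorem dict_r_nonneg {β : ℝ} (hβ : 0 ≤ β) (G₁ : SimpleGraph V) [DecidableRel G₁.Adj]
    (r : Finset (Sym2 V) → Finset (Sym2 V) → Finset (Sym2 V) → Sym2 V → ℝ)
    (hr : ∀ F F' T x, r F F' T x = (if x ∈ F' then Real.tanh β else 1) *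
      (if x ∈ G₁.edgeSet then Real.cosh β ^ 2 * (if x ∈ F then Real.tanh β else 1) *
          (if x ∈ F ∨ x ∈ F' then (if x ∈ T then 1 else 0)
            else (if x ∈ T then Real.tanh β ^ 2 else 1 - Real.tanh β ^ 2))
        else (if x ∈ F then 0 else 1) * Real.cosh β))
    (F F' T : Finset (Sym2 V)) (x : Sym2 V) : 0 ≤ r F F' T x := by
  have ht : 0 ≤ Real.tanh β := by
    rw [Real.tanh_eq_sinh_div_cosh]; exact div_nonneg (Real.sinh_nonneg_iff.2 hβ) (Real.cosh_pos β).le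
  have h1 := dict_one_sub_tanh_sq_nonneg β
  rw [hr]
  refine mul_nonneg (by split_ifs <;> positivity) ?_
  split_ifs <;> positivity

end Chains

/-- **twoCurrentTraceExpansion** (current side of the two-current trace dictionary).  For a finite
graph `G`, a graph `G₁` (`E₁ = E(G) ∩ E(G₁)`), `β ≥ 0`, source sets `A, B`, a test function `g` and
the explicit edge factor `r` (in `t = tanh β`): the double current sum of
`1[n₁ ⊆ E(G₁), ∂n₁ = A] w(n₁) 1[∂n₂ = B] w(n₂) g(E₁ ∩ trace(n₁ + n₂))` equals
`∑_{F, F′ ⊆ E(G)} ∑_{T ⊆ E₁} 1[∂F = A] 1[∂F′ = B] g(T) ∏_{e ∈ E(G)} r_e(F, F′, T)` — decompose along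
the odd parts `F = odd(n₁)`, `F′ = odd(n₂)` and the trace `T` (`dict_summand_eq`), exchange the sums,
and evaluate the per-edge multiplicity series (`dict_edge_tsum`: `sinh`, `cosh`, `cosh² − 1 = sinh²`).
Refs: Aizenman 1982 §3; Duminil-Copin 2016 Remark 3.4; Hansen–Jiang–Klausen 2025 §2. -/
theorem twoCurrentTraceExpansion :
    ∀ (V : Type) [Fintype V] [DecidableEq V] (G : SimpleGraph V) [DecidableRel G.Adj]
      (G₁ : SimpleGraph V) [DecidableRel G₁.Adj] (β : ℝ), 0 ≤ β →
      ∀ (A B : Finset V) (g : Finset (Sym2 V) → ℝ≥0∞)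
        (r : Finset (Sym2 V) → Finset (Sym2 V) → Finset (Sym2 V) → Sym2 V → ℝ),
      (∀ F F' T x, r F F' T x = (if x ∈ F' then Real.tanh β else 1) *
        (if x ∈ G₁.edgeSet then Real.cosh β ^ 2 * (if x ∈ F then Real.tanh β else 1) *
            (if x ∈ F ∨ x ∈ F' then (if x ∈ T then 1 else 0)
              else (if x ∈ T then Real.tanh β ^ 2 else 1 - Real.tanh β ^ 2))
          else (if x ∈ F then 0 else 1) * Real.cosh β)) →
      ∑' p : Current G × Current G,
          (if Current.IsSupp G₁ p.1 ∧ p.1.sources = A then p.1.eweight (fun _ => β) else 0) *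
            (if p.2.sources = B then p.2.eweight (fun _ => β) else 0) *
            g ((G.edgeFinset.filter fun e => e ∈ G₁.edgeSet).filter fun e => e ∈ (p.1 + p.2).traced) =
        ∑ F ∈ G.edgeFinset.powerset, ∑ F' ∈ G.edgeFinset.powerset,
          ∑ T ∈ (G.edgeFinset.filter fun e => e ∈ G₁.edgeSet).powerset,
            ind (∀ v, Odd #(F.filter (v ∈ ·)) ↔ v ∈ A) * ind (∀ v, Odd #(F'.filter (v ∈ ·)) ↔ v ∈ B) *
              g T * ENNReal.ofReal (∏ e : G.edgeFinset, r F F' T e) := by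
  intro V _ _ G _ G₁ _ β hβ A B g r hr
  set φ : Finset (Sym2 V) → Finset (Sym2 V) → Finset (Sym2 V) → G.edgeFinset → ℕ → ℕ → ℝ≥0∞ :=
    fun F F' T e j k => ind ((Odd j ↔ (e : Sym2 V) ∈ F) ∧ ((e : Sym2 V) ∉ G₁.edgeSet → j = 0)) *
      edgeWeight β j *
      (ind ((Odd k ↔ (e : Sym2 V) ∈ F') ∧ ((e : Sym2 V) ∉ G.edgeSet → k = 0)) * edgeWeight β k) *
      ind ((e : Sym2 V) ∈ G₁.edgeSet → (((e : Sym2 V) ∈ T) ↔ 0 < j + k)) with hφ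
  have hX := dict_summand_eq hβ G₁ A B g φ (fun F F' T e j k => by rw [hφ])
  rw [ENNReal.tsum_prod']
  dsimp only
  simp_rw [hX, dict_tsum_sum3, ENNReal.tsum_mul_left]
  refine sum_congr rfl fun F _ => sum_congr rfl fun F' _ => sum_congr rfl fun T _ => ?_
  rw [dict_tsum_tsum_prod (φ F F' T), ENNReal.ofReal_prod_of_nonneg (s := univ)
    (f := fun e : G.edgeFinset => r F F' T e) fun e _ => dict_r_nonneg hβ G₁ r hr F F' T e]
  congr 1
  refine prod_congr rfl fun e _ => ?_
  simp only [hφ]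
  rw [hr]
  exact dict_edge_tsum hβ _ _ _ _ _ (mem_edgeFinset.1 e.2)

end Summit.CriticalPhenomena.Ising3DConformalLimit.Theorems.StrandShadowOddCut

end
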